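import Summits.QuantumFields.BalabanUV.Beta.GAN24.PerturbedPropagatorVolumeLimit

/-!
# `BalabanUV.Beta.GAN24.EffectiveFormVolumeLimitAnyVolume` — binder row G-an2-4 ∕ (CONV-C), route R7 «TWO CURRENCIES», PART 155: THE EFFECTIVE FORM's `ℤ^d` END ALONG ANY VOLUME
# SEQUENCE AND IN ANY DIMENSION `d ≥ 2`, MODULO ONLY THE FINE PROPAGATOR's ENTRY LIMITS.  PARTs 138–140 proved `Σ_k = (Q_k𝒢Q_kᴴ)⁻¹ − a·1`'s END unconditionally for `d ≥ 3` along
# the EVEN cubic volumes — both restrictions are inherited from ONE input, an5's `calG_tendsto_Kinf` (EL₂ of `𝒢 = Δ_a⁻¹`).  This file ISOLATES that input: along ANY `side t → ∞` and for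
# ANY `d ≥ 2`, IF `𝒢^{(k)}` has pair entry limits at fine integer readings (EL₂ — DISPLAYED) THEN `c_k`, `c_k⁻¹` and `Σ_k` have pair entry limits on the unit lattice and `Σ_k` has the
# β-cell's whole `LimitRate` END — everything else ((γ) the Neumann ratio, (α) the window decay, the unit-lattice stencil, PART 144's inverses without translation invariance, PART 132's
# (UD)+(SR), PART 140's generic END) already holds for every cubic torus and every `d ≥ 2`.  So census item V184 («all d ∕ all volumes») is EXACTLY the `ℤ^d` limit of `𝒢` (the gauge
# term `∂P_c∂*` of `Δ_a` is not a finite-range stencil — `P_c` contains the massless scalar `Δ⁻¹` — so PART 144 does not apply to `Δ_a` itself) (unit b2b-balaban-gan24-p3, gen 55; v1)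

NOT IN PRINT; OUR PROOF ([folklore] bookkeeping BY NAME over PART 151 (`tendsto_avgTow_pair_of_fine`), PART 144 (`exists_tendsto_inv_pair`), PART 143 (`tendsto_one_pair`), PART 140
(`conv_of_decay_of_tendsto`), PART 138 (`opNorm_one_sub_smul_unitCovB_le`, `one_sub_gammaB_div_Cst_lt_one`, `exists_windowDecay_unitCovB`, `reindex_unitCovB_shift`), PART 132 (`decay_effForm`);
[Balaban1987RG1] (1.21)–(1.22) p. 264 LOCATE the shapes; nothing printed is a hypothesis).
HONEST FRAMING (cell contract, verbatim): «discharging `BetaPertH` makes Bałaban's UV stability UNCONDITIONAL — a real constructive-QFT result; it is NOT the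
continuum limit and NOT the Clay problem.»  HONEST DEPENDENCY (verbatim): «continuum YM on T⁴ ⇐ BetaPertH ∧ nine spine estimates (0/9 proved); BetaPertH ⇐
(D1) ∧ (D4) ∧ CAP+tail; G-an2-4 gates asym, D1 and NE2/3/4.»

WHAT THIS FILE PROVES (0 sorry, 0 `def`; `e = unitIdx⁻¹`; EL₂(𝒢) ≡ `∀ f g z z′, ∃ s, 𝒢^{(k)}_t((ẑ_t,f),(ẑ′_t,g)) → s` at fine integer readings along `side t → ∞`):
* §1 `reindex_unitCovB_pair_le` ((α) at PAIRS by shift invariance), **`tendsto_unitCovB_pair_of_fine`** (EL₂(𝒢) ⟹ EL₂ of `c_k` on the unit lattice; any `d`, any `side`),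
  **`tendsto_inv_unitCovB_pair_of_fine`** (`d ≥ 1`: ⟹ EL₂ of `c_k⁻¹`), **`tendsto_effForm_pair_of_fine`** (⟹ EL₂ of `Σ_k`).
* §2 **`conv_effForm_of_fineLimit`** — `d ≥ 2`, `L ≥ 2`, `a > 0`, `μ ≠ ν`, ANY cubic volume sequence `side t → ∞`: EL₂(𝒢) for every level ⟹ `∃ Π` with `IsInfiniteVolumeLimit side (Re Σ_k(e(·,μ′),e(0,ν′))) (Π k)`,
  `UniformDecay Π μ ν Bs (κ′∕d)`, `StepRate Π μ ν Bs′ (κ′∕d) (√(L⁻¹))`, `KernelInputs d Π`, `|secondMoment (Π k) μ ν − secondMoment Π_∞ μ ν| ≤ β′_d(Bs′∕(1−√(L⁻¹)), κ′∕d)·(√(L⁻¹))^k` (PART 132's constants).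
WHAT IT DOES NOT DO: prove EL₂(𝒢) beyond an5's case (`d ≥ 3`, even volumes — there PART 139 is unconditional); `U ≠ 1` (PARTs 151–152 could be made conditional the same way — follower).
SUPPLIER work; NEVER «G-an2-4 closed»; NOT (CONV-C), NOT D1, NOT `BetaPertH`, NOT continuum, NOT Clay.  Records: `HOME/b2b-balaban-gan24-p3/gen55/README.md`.
-/

noncomputable section

open scoped BigOperators ComplexConjugate Matrix Matrix.Norms.L2Operator
open Filter Topology

namespace Summit.QuantumFields.BalabanUV.Beta.GAN24.EffectiveFormVolumeLimitAnyVolume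

open Literature.MathematicalPhysics.QuantumFieldTheory.Balaban1983to89
open Literature.MathematicalPhysics.QuantumFieldTheory.Balaban1983to89.B5Prop11Plancherel (Tor fine Cst)
open Literature.MathematicalPhysics.QuantumFieldTheory.Balaban1983to89.B5G183RateUnitTower (lev)
open Literature.MathematicalPhysics.QuantumFieldTheory.Balaban1983to89.B12Sec2to5 (l1 betaPrime510)
open Literature.MathematicalPhysics.QuantumFieldTheory.Balaban1983to89.Beta (Site windowMap IsInfiniteVolumeLimit)
open Literature.MathematicalPhysics.QuantumFieldTheory.Balaban1983to89.Beta.FreeLegDictionary (cubic)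
open Literature.MathematicalPhysics.QuantumFieldTheory.Balaban1983to89.Beta.VectorTails (castT)
open Literature.MathematicalPhysics.QuantumFieldTheory.Balaban1983to89.Beta.LimitRate (StepRate limKernelOf KernelInputs)
open Summit.QuantumFields.BalabanUV.T4Continuum
open Summit.QuantumFields.BalabanUV.T4Continuum.BalabanAveragedTowerUnit (idx QBlev calGlev unitCovB)
open Summit.QuantumFields.BalabanUV.T4Continuum.BalabanAveragedCoercive (gammaB)
open Summit.QuantumFields.BalabanUV.T4Continuum.BalabanAveragedCoerciveTower (unitIdx)
open Summit.QuantumFields.BalabanUV.T4Continuum.CTKingTowerWeights (distK)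
open Summit.QuantumFields.BalabanUV.T4Continuum.DecayRateInterpolation (EntryDecay TwoLevelDecayRate)
open Summit.QuantumFields.BalabanUV.Beta.GAN24.DiagramDecayTorus (decay_effForm)
open Summit.QuantumFields.BalabanUV.Beta.GAN24.VolumeLimitCovariance (opNorm_one_sub_smul_unitCovB_le one_sub_gammaB_div_Cst_lt_one exists_windowDecay_unitCovB reindex_unitCovB_shift)
open Summit.QuantumFields.BalabanUV.Beta.GAN24.DiagramVolumeLimit (conv_of_decay_of_tendsto)
open Summit.QuantumFields.BalabanUV.Beta.GAN24.DiagramVolumeLimitSandwich (tendsto_one_pair)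
open Summit.QuantumFields.BalabanUV.Beta.GAN24.VolumeLimitPairsFibre (exists_tendsto_inv_pair)
open Summit.QuantumFields.BalabanUV.Beta.GAN24.PerturbedPropagatorVolumeLimit (tendsto_avgTow_pair_of_fine)

variable {d : ℕ} (L : ℕ) [NeZero L] (a : ℝ) (ha : 0 < a)

/-! ## §1 `c_k`, `c_k⁻¹`, `Σ_k`: pair entry limits on the unit lattice from the fine propagator's, along any volume sequence -/

section AnyVolume

variable {side : ℕ → ℕ} [∀ t, NeZero (side t)]

/-- **(α) AT PAIRS**: PART 138's window decay of `c_k` from the origin, moved to an arbitrary pair by block-translation invariance (`reindex_unitCovB_shift`): `∃ κ > 0, B ≥ 0` (from `(d, a)`) with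
`‖c_k((w,μ),(y,ν))‖ ≤ B·e^{−(κ∕d)|windowMap(w − y)|₁}` on every cubic torus and level. [folklore] -/
theorem reindex_unitCovB_pair_le :
    ∃ κ B : ℝ, 0 < κ ∧ 0 ≤ B ∧ ∀ (s : ℕ) [NeZero s] (k : ℕ) (w : Site d s) (μ : Fin d) (y : Site d s) (ν : Fin d),
      ‖Matrix.reindex (unitIdx L (cubic d s)) (unitIdx L (cubic d s)) (unitCovB L (cubic d s) a ha k) (w, μ) (y, ν)‖ ≤ B * Real.exp (-(κ / d) * l1 (windowMap d s (w - y))) := by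
  obtain ⟨κ, B, hκ, hB, h⟩ := exists_windowDecay_unitCovB L a ha
  refine ⟨κ, B, hκ, hB, fun s _ k w μ y ν => ?_⟩
  have e : Matrix.reindex (unitIdx L (cubic d s)) (unitIdx L (cubic d s)) (unitCovB L (cubic d s) a ha k) (w, μ) (y, ν)
      = Matrix.reindex (unitIdx L (cubic d s)) (unitIdx L (cubic d s)) (unitCovB L (cubic d s) a ha k) (w - y, μ) (0, ν) := by
    have hsh := reindex_unitCovB_shift L (cubic d s) a ha k (w - y) μ 0 ν y
    rw [sub_add_cancel, zero_add] at hsh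
    exact hsh
  rw [e]
  exact h s k μ ν (w - y)

/-- **`tendsto_unitCovB_pair_of_fine` — EL₂ OF `c_k` FROM EL₂ OF `𝒢^{(k)}`** [folklore] (any `d`, any `L`, any cubic volume sequence): PART 151's middle-free stencil at the middle kernel
`𝒢^{(k)}` (`c_k = L^{dk}Q_k𝒢^{(k)}Q_kᴴ` by definition). -/
theorem tendsto_unitCovB_pair_of_fine (k : ℕ)
    (hG : ∀ (f g : Fin d) (z z' : Fin d → ℤ), ∃ s : ℂ,
      Tendsto (fun t => calGlev L (cubic d (side t)) a ha k (castT (cubic d (lev L k * side t)) z, f) (castT (cubic d (lev L k * side t)) z', g)) atTop (𝓝 s))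
    (μ ν : Fin d) (z z' : Fin d → ℤ) :
    ∃ s : ℂ, Tendsto (fun t => Matrix.reindex (unitIdx L (cubic d (side t))) (unitIdx L (cubic d (side t))) (unitCovB L (cubic d (side t)) a ha k)
      (castT (cubic d (side t)) z, μ) (castT (cubic d (side t)) z', ν)) atTop (𝓝 s) :=
  tendsto_avgTow_pair_of_fine L k (X := fun t k' => calGlev L (cubic d (side t)) a ha k') hG μ ν z z'

/-- **`tendsto_inv_unitCovB_pair_of_fine` — EL₂ OF `c_k⁻¹` FROM EL₂ OF `𝒢^{(k)}`** [our proof] (`d ≥ 1`, any cubic `side t → ∞`): PART 144's `exists_tendsto_inv_pair` on `A_t = c_k` read on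
`Site × Fin d` with (a) PART 138's ratio `‖1 − Cst⁻¹•c_k‖ ≤ 1 − γ_B∕Cst`, (b) `reindex_unitCovB_pair_le`, (c) `tendsto_unitCovB_pair_of_fine`. -/
theorem tendsto_inv_unitCovB_pair_of_fine (hd : 1 ≤ d) (hside : Tendsto side atTop atTop) (k : ℕ)
    (hG : ∀ (f g : Fin d) (z z' : Fin d → ℤ), ∃ s : ℂ,
      Tendsto (fun t => calGlev L (cubic d (side t)) a ha k (castT (cubic d (lev L k * side t)) z, f) (castT (cubic d (lev L k * side t)) z', g)) atTop (𝓝 s))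
    (μ ν : Fin d) (z z' : Fin d → ℤ) :
    ∃ s : ℂ, Tendsto (fun t => (unitCovB L (cubic d (side t)) a ha k)⁻¹
      ((unitIdx L (cubic d (side t))).symm (castT (cubic d (side t)) z, μ)) ((unitIdx L (cubic d (side t))).symm (castT (cubic d (side t)) z', ν))) atTop (𝓝 s) := by
  have hd0 : (0 : ℝ) < d := by exact_mod_cast lt_of_lt_of_le zero_lt_one hd
  obtain ⟨κ, B, hκ, -, hdec⟩ := reindex_unitCovB_pair_le L a ha (d := d)
  obtain ⟨s, hs⟩ := exists_tendsto_inv_pair (d := d) (F := Fin d) (side := side) hside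
    (A := fun t => Matrix.reindex (unitIdx L (cubic d (side t))) (unitIdx L (cubic d (side t))) (unitCovB L (cubic d (side t)) a ha k))
    (τ := (((Cst d a)⁻¹ : ℝ) : ℂ)) (fun t => opNorm_one_sub_smul_unitCovB_le L (cubic d (side t)) a ha hd k) (one_sub_gammaB_div_Cst_lt_one a ha)
    (fun t w g y h => hdec (side t) k w g y h) (div_pos hκ hd0) (tendsto_unitCovB_pair_of_fine L a ha k hG) μ ν z z'
  refine ⟨s, hs.congr fun t => ?_⟩
  rw [Matrix.inv_reindex]
  simp only [Matrix.reindex_apply, Matrix.submatrix_apply]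

/-- **`tendsto_effForm_pair_of_fine` — EL₂ OF THE EFFECTIVE FORM `Σ_k = c_k⁻¹ − a·1` FROM EL₂ OF `𝒢^{(k)}`** [our proof] (`d ≥ 1`, any cubic `side t → ∞`). -/
theorem tendsto_effForm_pair_of_fine (hd : 1 ≤ d) (hside : Tendsto side atTop atTop) (k : ℕ)
    (hG : ∀ (f g : Fin d) (z z' : Fin d → ℤ), ∃ s : ℂ,
      Tendsto (fun t => calGlev L (cubic d (side t)) a ha k (castT (cubic d (lev L k * side t)) z, f) (castT (cubic d (lev L k * side t)) z', g)) atTop (𝓝 s))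
    (μ ν : Fin d) (z z' : Fin d → ℤ) :
    ∃ s : ℂ, Tendsto (fun t => ((unitCovB L (cubic d (side t)) a ha k)⁻¹ - (a : ℂ) • (1 : Matrix (idx L (cubic d (side t)) 0) (idx L (cubic d (side t)) 0) ℂ))
      ((unitIdx L (cubic d (side t))).symm (castT (cubic d (side t)) z, μ)) ((unitIdx L (cubic d (side t))).symm (castT (cubic d (side t)) z', ν))) atTop (𝓝 s) := by
  obtain ⟨s₁, hs₁⟩ := tendsto_inv_unitCovB_pair_of_fine L a ha hd hside k hG μ ν z z'
  obtain ⟨s₂, hs₂⟩ := tendsto_one_pair L (d := d) hside μ ν z z'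
  refine ⟨s₁ - (a : ℂ) * s₂, ?_⟩
  simp only [Matrix.sub_apply, Matrix.smul_apply, smul_eq_mul]
  exact hs₁.sub (hs₂.const_mul (a : ℂ))

end AnyVolume

/-! ## §2 The END along any volume sequence, `d ≥ 2`, modulo EL₂ of the fine propagator -/

/-- **`conv_effForm_of_fineLimit` — THE EFFECTIVE FORM's `ℤ^d` END ALONG ANY CUBIC VOLUME SEQUENCE, `d ≥ 2`, MODULO ONLY EL₂ OF THE FINE PROPAGATOR** [our proof] (`L ≥ 2`, `a > 0`,
`μ ≠ ν`, `side t → ∞`): if for every level `k` the fine propagator `𝒢^{(k)}` has pair entry limits at fine integer readings along `side` (DISPLAYED — an5's theorem supplies it for `d ≥ 3`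
along the even volumes), then `Σ_k = (Q_k𝒢Q_kᴴ)⁻¹ − a·1` has: limit kernels `Π_k` with `IsInfiniteVolumeLimit side (Re Σ_k(e(·,μ′), e(0,ν′))) (Π k)`, `UniformDecay Π μ ν Bs (κ′∕d)`,
`StepRate Π μ ν Bs′ (κ′∕d) (√(L⁻¹))`, `KernelInputs d Π` inhabited, `∀ k, |secondMoment (Π k) μ ν − secondMoment (limKernelOf Π) μ ν| ≤ β′_d(Bs′∕(1−√(L⁻¹)), κ′∕d)·(√(L⁻¹))^k`, with PART 132's
`κ′ > 0`, `Bs, Bs′ ≥ 0` from `(d, L, a)`.  Census V184 made precise: `d ≥ 3` and evenness enter ONLY through EL₂(𝒢). [cite: Balaban1987RG1, (1.21)–(1.22) p.264 (shapes)] -/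
theorem conv_effForm_of_fineLimit (hL : 2 ≤ L) (hd : 2 ≤ d) {μ ν : Fin d} (hne : μ ≠ ν) {side : ℕ → ℕ} [∀ t, NeZero (side t)] (hside : Tendsto side atTop atTop)
    (hG : ∀ (k : ℕ) (f g : Fin d) (z z' : Fin d → ℤ), ∃ s : ℂ,
      Tendsto (fun t => calGlev L (cubic d (side t)) a ha k (castT (cubic d (lev L k * side t)) z, f) (castT (cubic d (lev L k * side t)) z', g)) atTop (𝓝 s)) :
    ∃ κ' Bs Bs' : ℝ, 0 < κ' ∧ 0 ≤ Bs ∧ 0 ≤ Bs' ∧ ∃ Pinf : ℕ → B12Beta.Kernel d,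
      (∀ k, IsInfiniteVolumeLimit side
        (fun t μ' ν' (z : Site d (side t)) => (((unitCovB L (cubic d (side t)) a ha k)⁻¹ - (a : ℂ) • (1 : Matrix (idx L (cubic d (side t)) 0) (idx L (cubic d (side t)) 0) ℂ))
          ((unitIdx L (cubic d (side t))).symm (z, μ')) ((unitIdx L (cubic d (side t))).symm (0, ν'))).re) (Pinf k)) ∧
      Beta.LimitRate.UniformDecay Pinf μ ν Bs (κ' / d) ∧ StepRate Pinf μ ν Bs' (κ' / d) (Real.sqrt ((L : ℝ)⁻¹)) ∧
      (∃ K : KernelInputs d Pinf, K.θ = Real.sqrt ((L : ℝ)⁻¹) ∧ K.c₀ = betaPrime510 d (Bs' / (1 - Real.sqrt ((L : ℝ)⁻¹))) (κ' / d) ∧ K.Pinf = limKernelOf Pinf ∧ K.μ = μ ∧ K.ν = ν) ∧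
      (∀ k, |B12Beta.secondMoment (Pinf k) μ ν - B12Beta.secondMoment (limKernelOf Pinf) μ ν|
          ≤ betaPrime510 d (Bs' / (1 - Real.sqrt ((L : ℝ)⁻¹))) (κ' / d) * Real.sqrt ((L : ℝ)⁻¹) ^ k) := by
  have hd1 : 1 ≤ d := le_trans one_le_two hd
  have hL1 : (1 : ℝ) < L := by exact_mod_cast (lt_of_lt_of_le one_lt_two hL : 1 < L)
  have hθ0 : 0 ≤ Real.sqrt ((L : ℝ)⁻¹) := Real.sqrt_nonneg _
  have hθ1 : Real.sqrt ((L : ℝ)⁻¹) < 1 := by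
    rw [show (1 : ℝ) = Real.sqrt 1 from Real.sqrt_one.symm]
    exact Real.sqrt_lt_sqrt (inv_nonneg.mpr (Nat.cast_nonneg _)) (inv_lt_one_of_one_lt₀ hL1)
  obtain ⟨κ', Bs, Bs', hκ', hBs, hBs', h⟩ := decay_effForm L a ha hL hd
  refine ⟨κ', Bs, Bs', hκ', hBs, hBs', ?_⟩
  refine conv_of_decay_of_tendsto L hd1 hside hκ' hθ0 hθ1 (fun t k => (h (cubic d (side t))).1 k) (fun t => (h (cubic d (side t))).2) ?_ hne
  intro k μ' ν' z
  obtain ⟨s, hs⟩ := tendsto_effForm_pair_of_fine L a ha hd1 hside k (hG k) μ' ν' z 0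
  have e0 : ∀ t, castT (cubic d (side t)) (0 : Fin d → ℤ) = 0 := fun t => by funext i; simp [castT]
  refine ⟨s, hs.congr fun t => ?_⟩
  rw [e0]

end Summit.QuantumFields.BalabanUV.Beta.GAN24.EffectiveFormVolumeLimitAnyVolume

end
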